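import Summits.RiemannHypothesis.RiemannHypothesis.Theorems.SignConeOscillatory.Negative.OriginDominatingNumerics

/-!
# `OscSingleWindow` (crux stmt-RiemannHypothesis-18012) — negative lemma "origin domination does not substitute for
# positive-definiteness inside the single window": numerics layer

Companion of `Theorems/OscSingleWindow/Negative/WithoutPDOriginDominating.lean` (crux-disprover record of seat
`refuter-cdisprove-stmt-RiemannHypothesis-18012-0`, cycle 1; `--supports`, closes nothing).  For the combined
polar + archimedean density `D(t) = y·B(v) + 2v²/(v⁴ - 1)` (`v = e^{t/2}`, `y = F(t)`;
`SignConeOscillatory.Negative.dfun_eq`) of a real even origin-dominating witness with `F(0) = 1`, this file supplies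

* 20 decimal lower bounds of `exp` at the far-cell endpoints (Taylor partial sums, `Real.sum_le_exp_of_nonneg`);
* the 19 FAR cell bounds `swcell6 … swcell24` on the partition `0.68 < 0.74 < … < 3.0003 < … < 3.3312` of the
  single-window witness (cells with `y ≤ 0`: `D ≤ 1/sinh` via `cell_neg_shoulder`; the four window plateaus
  `y = -1`: `cell_neg_one`) — the six near-field cells `0 … 0.68` are the parent's `ncell0 … ncell5` verbatim;
* the numeric tail `2e^{-3.3312}/(1 - e^{-6.6624}) ≤ 0.07161`.

No definitions.
-/

noncomputable section

-- `Summit.RiemannHypothesis.RiemannHypothesis.…` repeats a namespace component by design (D-0017 layout).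
set_option linter.dupNamespace false

namespace Summit.RiemannHypothesis.RiemannHypothesis.Theorems.OscSingleWindow.Negative

open Summit.RiemannHypothesis.RiemannHypothesis.Theorems.SignConeOscillatory.Negative

/-! ## Decimal lower bounds of `exp` at the far-cell endpoints (Taylor partial sums, 15 terms) -/

/-- `1.40494759 ≤ exp 0.34` (Taylor partial sum). -/
theorem sw_exp_ge_0_34 : (1.40494759 : ℝ) ≤ Real.exp 0.34 := by
  have hx0 : (0 : ℝ) ≤ 0.34 := by norm_num
  have hl := Real.sum_le_exp_of_nonneg hx0 15
  simp only [Finset.sum_range_succ, Finset.sum_range_zero] at hl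
  exact le_trans (by norm_num [Nat.factorial]) hl

/-- `1.447734614 ≤ exp 0.37` (Taylor partial sum). -/
theorem sw_exp_ge_0_37 : (1.447734614 : ℝ) ≤ Real.exp 0.37 := by
  have hx0 : (0 : ℝ) ≤ 0.37 := by norm_num
  have hl := Real.sum_le_exp_of_nonneg hx0 15
  simp only [Finset.sum_range_succ, Finset.sum_range_zero] at hl
  exact le_trans (by norm_num [Nat.factorial]) hl

/-- `1.506817785 ≤ exp 0.41` (Taylor partial sum). -/
theorem sw_exp_ge_0_41 : (1.506817785 : ℝ) ≤ Real.exp 0.41 := by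
  have hx0 : (0 : ℝ) ≤ 0.41 := by norm_num
  have hl := Real.sum_le_exp_of_nonneg hx0 15
  simp only [Finset.sum_range_succ, Finset.sum_range_zero] at hl
  exact le_trans (by norm_num [Nat.factorial]) hl

/-- `1.584073984 ≤ exp 0.46` (Taylor partial sum). -/
theorem sw_exp_ge_0_46 : (1.584073984 : ℝ) ≤ Real.exp 0.46 := by
  have hx0 : (0 : ℝ) ≤ 0.46 := by norm_num
  have hl := Real.sum_le_exp_of_nonneg hx0 15
  simp only [Finset.sum_range_succ, Finset.sum_range_zero] at hl
  exact le_trans (by norm_num [Nat.factorial]) hl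

/-- `1.682027649 ≤ exp 0.52` (Taylor partial sum). -/
theorem sw_exp_ge_0_52 : (1.682027649 : ℝ) ≤ Real.exp 0.52 := by
  have hx0 : (0 : ℝ) ≤ 0.52 := by norm_num
  have hl := Real.sum_le_exp_of_nonneg hx0 15
  simp only [Finset.sum_range_succ, Finset.sum_range_zero] at hl
  exact le_trans (by norm_num [Nat.factorial]) hl

/-- `1.803988415 ≤ exp 0.59` (Taylor partial sum). -/
theorem sw_exp_ge_0_59 : (1.803988415 : ℝ) ≤ Real.exp 0.59 := by
  have hx0 : (0 : ℝ) ≤ 0.59 := by norm_num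
  have hl := Real.sum_le_exp_of_nonneg hx0 15
  simp only [Finset.sum_range_succ, Finset.sum_range_zero] at hl
  exact le_trans (by norm_num [Nat.factorial]) hl

/-- `1.964032975 ≤ exp 0.675` (Taylor partial sum). -/
theorem sw_exp_ge_0_675 : (1.964032975 : ℝ) ≤ Real.exp 0.675 := by
  have hx0 : (0 : ℝ) ≤ 0.675 := by norm_num
  have hl := Real.sum_le_exp_of_nonneg hx0 15
  simp only [Finset.sum_range_succ, Finset.sum_range_zero] at hl
  exact le_trans (by norm_num [Nat.factorial]) hl

/-- `2.170592127 ≤ exp 0.775` (Taylor partial sum). -/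
theorem sw_exp_ge_0_775 : (2.170592127 : ℝ) ≤ Real.exp 0.775 := by
  have hx0 : (0 : ℝ) ≤ 0.775 := by norm_num
  have hl := Real.sum_le_exp_of_nonneg hx0 15
  simp only [Finset.sum_range_succ, Finset.sum_range_zero] at hl
  exact le_trans (by norm_num [Nat.factorial]) hl

/-- `2.459603111 ≤ exp 0.9` (Taylor partial sum). -/
theorem sw_exp_ge_0_9 : (2.459603111 : ℝ) ≤ Real.exp 0.9 := by
  have hx0 : (0 : ℝ) ≤ 0.9 := by norm_num
  have hl := Real.sum_le_exp_of_nonneg hx0 15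
  simp only [Finset.sum_range_succ, Finset.sum_range_zero] at hl
  exact le_trans (by norm_num [Nat.factorial]) hl

/-- `2.886370989 ≤ exp 1.06` (Taylor partial sum). -/
theorem sw_exp_ge_1_06 : (2.886370989 : ℝ) ≤ Real.exp 1.06 := by
  have hx0 : (0 : ℝ) ≤ 1.06 := by norm_num
  have hl := Real.sum_le_exp_of_nonneg hx0 15
  simp only [Finset.sum_range_succ, Finset.sum_range_zero] at hl
  exact le_trans (by norm_num [Nat.factorial]) hl

/-- `3.525421487 ≤ exp 1.26` (Taylor partial sum). -/
theorem sw_exp_ge_1_26 : (3.525421487 : ℝ) ≤ Real.exp 1.26 := by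
  have hx0 : (0 : ℝ) ≤ 1.26 := by norm_num
  have hl := Real.sum_le_exp_of_nonneg hx0 15
  simp only [Finset.sum_range_succ, Finset.sum_range_zero] at hl
  exact le_trans (by norm_num [Nat.factorial]) hl

/-- `4.48908996 ≤ exp 1.50165` (Taylor partial sum). -/
theorem sw_exp_ge_1_50165 : (4.48908996 : ℝ) ≤ Real.exp 1.50165 := by
  have hx0 : (0 : ℝ) ≤ 1.50165 := by norm_num
  have hl := Real.sum_le_exp_of_nonneg hx0 15
  simp only [Finset.sum_range_succ, Finset.sum_range_zero] at hl
  exact le_trans (by norm_num [Nat.factorial]) hl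

/-- `4.572453811 ≤ exp 1.52005` (Taylor partial sum). -/
theorem sw_exp_ge_1_52005 : (4.572453811 : ℝ) ≤ Real.exp 1.52005 := by
  have hx0 : (0 : ℝ) ≤ 1.52005 := by norm_num
  have hl := Real.sum_le_exp_of_nonneg hx0 15
  simp only [Finset.sum_range_succ, Finset.sum_range_zero] at hl
  exact le_trans (by norm_num [Nat.factorial]) hl

/-- `4.907182753 ≤ exp 1.5907` (Taylor partial sum). -/
theorem sw_exp_ge_1_5907 : (4.907182753 : ℝ) ≤ Real.exp 1.5907 := by
  have hx0 : (0 : ℝ) ≤ 1.5907 := by norm_num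
  have hl := Real.sum_le_exp_of_nonneg hx0 15
  simp only [Finset.sum_range_succ, Finset.sum_range_zero] at hl
  exact le_trans (by norm_num [Nat.factorial]) hl

/-- `4.991567555 ≤ exp 1.60775` (Taylor partial sum). -/
theorem sw_exp_ge_1_60775 : (4.991567555 : ℝ) ≤ Real.exp 1.60775 := by
  have hx0 : (0 : ℝ) ≤ 1.60775 := by norm_num
  have hl := Real.sum_le_exp_of_nonneg hx0 15
  simp only [Finset.sum_range_succ, Finset.sum_range_zero] at hl
  exact le_trans (by norm_num [Nat.factorial]) hl

/-- `5.008317346 ≤ exp 1.6111` (Taylor partial sum). -/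
theorem sw_exp_ge_1_6111 : (5.008317346 : ℝ) ≤ Real.exp 1.6111 := by
  have hx0 : (0 : ℝ) ≤ 1.6111 := by norm_num
  have hl := Real.sum_le_exp_of_nonneg hx0 15
  simp only [Finset.sum_range_succ, Finset.sum_range_zero] at hl
  exact le_trans (by norm_num [Nat.factorial]) hl

/-- `5.088586037 ≤ exp 1.627` (Taylor partial sum). -/
theorem sw_exp_ge_1_627 : (5.088586037 : ℝ) ≤ Real.exp 1.627 := by
  have hx0 : (0 : ℝ) ≤ 1.627 := by norm_num
  have hl := Real.sum_le_exp_of_nonneg hx0 15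
  simp only [Finset.sum_range_succ, Finset.sum_range_zero] at hl
  exact le_trans (by norm_num [Nat.factorial]) hl

/-- `5.20489745 ≤ exp 1.6496` (Taylor partial sum). -/
theorem sw_exp_ge_1_6496 : (5.20489745 : ℝ) ≤ Real.exp 1.6496 := by
  have hx0 : (0 : ℝ) ≤ 1.6496 := by norm_num
  have hl := Real.sum_le_exp_of_nonneg hx0 15
  simp only [Finset.sum_range_succ, Finset.sum_range_zero] at hl
  exact le_trans (by norm_num [Nat.factorial]) hl

/-- `5.280918282 ≤ exp 1.6641` (Taylor partial sum). -/
theorem sw_exp_ge_1_6641 : (5.280918282 : ℝ) ≤ Real.exp 1.6641 := by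
  have hx0 : (0 : ℝ) ≤ 1.6641 := by norm_num
  have hl := Real.sum_le_exp_of_nonneg hx0 15
  simp only [Finset.sum_range_succ, Finset.sum_range_zero] at hl
  exact le_trans (by norm_num [Nat.factorial]) hl

/-- `5.288845603 ≤ exp 1.6656` (Taylor partial sum). -/
theorem sw_exp_ge_1_6656 : (5.288845603 : ℝ) ≤ Real.exp 1.6656 := by
  have hx0 : (0 : ℝ) ≤ 1.6656 := by norm_num
  have hl := Real.sum_le_exp_of_nonneg hx0 15
  simp only [Finset.sum_range_succ, Finset.sum_range_zero] at hl
  exact le_trans (by norm_num [Nat.factorial]) hl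

/-! ## The far cells `6 … 24` (`y ≤ 0`: `D ≤ 1/sinh`; plateaus `y = -1`) -/

/-- Cell 6: `t ∈ (0.68, 0.74)`, `F ≤ 0`. -/
theorem swcell6 {y t : ℝ} (ht : t ∈ Set.Ioo (0.68 : ℝ) 0.74) (hy : y ≤ 0) :
    y * (2 * (Real.exp (t / 2) + (Real.exp (t / 2))⁻¹) - 2 * Real.exp (t / 2) ^ 3 / (Real.exp (t / 2) ^ 4 - 1)) +
      2 * Real.exp (t / 2) ^ 2 / (Real.exp (t / 2) ^ 4 - 1) ≤ 1.3631 := by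
  have hv : (1.40494759 : ℝ) ≤ Real.exp (t / 2) := le_trans sw_exp_ge_0_34 (Real.exp_le_exp.2 (by linarith [ht.1]))
  exact le_trans (cell_neg_shoulder (by norm_num) hv (by norm_num) hy) (by norm_num)

/-- Cell 7: `t ∈ (0.74, 0.82)`, `F ≤ 0`. -/
theorem swcell7 {y t : ℝ} (ht : t ∈ Set.Ioo (0.74 : ℝ) 0.82) (hy : y ≤ 0) :
    y * (2 * (Real.exp (t / 2) + (Real.exp (t / 2))⁻¹) - 2 * Real.exp (t / 2) ^ 3 / (Real.exp (t / 2) ^ 4 - 1)) +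
      2 * Real.exp (t / 2) ^ 2 / (Real.exp (t / 2) ^ 4 - 1) ≤ 1.23548 := by
  have hv : (1.447734614 : ℝ) ≤ Real.exp (t / 2) := le_trans sw_exp_ge_0_37 (Real.exp_le_exp.2 (by linarith [ht.1]))
  exact le_trans (cell_neg_shoulder (by norm_num) hv (by norm_num) hy) (by norm_num)

/-- Cell 8: `t ∈ (0.82, 0.92)`, `F ≤ 0`. -/
theorem swcell8 {y t : ℝ} (ht : t ∈ Set.Ioo (0.82 : ℝ) 0.92) (hy : y ≤ 0) :
    y * (2 * (Real.exp (t / 2) + (Real.exp (t / 2))⁻¹) - 2 * Real.exp (t / 2) ^ 3 / (Real.exp (t / 2) ^ 4 - 1)) +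
      2 * Real.exp (t / 2) ^ 2 / (Real.exp (t / 2) ^ 4 - 1) ≤ 1.09287 := by
  have hv : (1.506817785 : ℝ) ≤ Real.exp (t / 2) := le_trans sw_exp_ge_0_41 (Real.exp_le_exp.2 (by linarith [ht.1]))
  exact le_trans (cell_neg_shoulder (by norm_num) hv (by norm_num) hy) (by norm_num)

/-- Cell 9: `t ∈ (0.92, 1.04)`, `F ≤ 0`. -/
theorem swcell9 {y t : ℝ} (ht : t ∈ Set.Ioo (0.92 : ℝ) 1.04) (hy : y ≤ 0) :
    y * (2 * (Real.exp (t / 2) + (Real.exp (t / 2))⁻¹) - 2 * Real.exp (t / 2) ^ 3 / (Real.exp (t / 2) ^ 4 - 1)) +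
      2 * Real.exp (t / 2) ^ 2 / (Real.exp (t / 2) ^ 4 - 1) ≤ 0.94754 := by
  have hv : (1.584073984 : ℝ) ≤ Real.exp (t / 2) := le_trans sw_exp_ge_0_46 (Real.exp_le_exp.2 (by linarith [ht.1]))
  exact le_trans (cell_neg_shoulder (by norm_num) hv (by norm_num) hy) (by norm_num)

/-- Cell 10: `t ∈ (1.04, 1.18)`, `F ≤ 0`. -/
theorem swcell10 {y t : ℝ} (ht : t ∈ Set.Ioo (1.04 : ℝ) 1.18) (hy : y ≤ 0) :
    y * (2 * (Real.exp (t / 2) + (Real.exp (t / 2))⁻¹) - 2 * Real.exp (t / 2) ^ 3 / (Real.exp (t / 2) ^ 4 - 1)) +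
      2 * Real.exp (t / 2) ^ 2 / (Real.exp (t / 2) ^ 4 - 1) ≤ 0.80785 := by
  have hv : (1.682027649 : ℝ) ≤ Real.exp (t / 2) := le_trans sw_exp_ge_0_52 (Real.exp_le_exp.2 (by linarith [ht.1]))
  exact le_trans (cell_neg_shoulder (by norm_num) hv (by norm_num) hy) (by norm_num)

/-- Cell 11: `t ∈ (1.18, 1.35)`, `F ≤ 0`. -/
theorem swcell11 {y t : ℝ} (ht : t ∈ Set.Ioo (1.18 : ℝ) 1.35) (hy : y ≤ 0) :
    y * (2 * (Real.exp (t / 2) + (Real.exp (t / 2))⁻¹) - 2 * Real.exp (t / 2) ^ 3 / (Real.exp (t / 2) ^ 4 - 1)) +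
      2 * Real.exp (t / 2) ^ 2 / (Real.exp (t / 2) ^ 4 - 1) ≤ 0.67865 := by
  have hv : (1.803988415 : ℝ) ≤ Real.exp (t / 2) := le_trans sw_exp_ge_0_59 (Real.exp_le_exp.2 (by linarith [ht.1]))
  exact le_trans (cell_neg_shoulder (by norm_num) hv (by norm_num) hy) (by norm_num)

/-- Cell 12: `t ∈ (1.35, 1.55)`, `F ≤ 0`. -/
theorem swcell12 {y t : ℝ} (ht : t ∈ Set.Ioo (1.35 : ℝ) 1.55) (hy : y ≤ 0) :
    y * (2 * (Real.exp (t / 2) + (Real.exp (t / 2))⁻¹) - 2 * Real.exp (t / 2) ^ 3 / (Real.exp (t / 2) ^ 4 - 1)) +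
      2 * Real.exp (t / 2) ^ 2 / (Real.exp (t / 2) ^ 4 - 1) ≤ 0.55585 := by
  have hv : (1.964032975 : ℝ) ≤ Real.exp (t / 2) := le_trans sw_exp_ge_0_675 (Real.exp_le_exp.2 (by linarith [ht.1]))
  exact le_trans (cell_neg_shoulder (by norm_num) hv (by norm_num) hy) (by norm_num)

/-- Cell 13: `t ∈ (1.55, 1.8)`, `F ≤ 0`. -/
theorem swcell13 {y t : ℝ} (ht : t ∈ Set.Ioo (1.55 : ℝ) 1.8) (hy : y ≤ 0) :
    y * (2 * (Real.exp (t / 2) + (Real.exp (t / 2))⁻¹) - 2 * Real.exp (t / 2) ^ 3 / (Real.exp (t / 2) ^ 4 - 1)) +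
      2 * Real.exp (t / 2) ^ 2 / (Real.exp (t / 2) ^ 4 - 1) ≤ 0.44454 := by
  have hv : (2.170592127 : ℝ) ≤ Real.exp (t / 2) := le_trans sw_exp_ge_0_775 (Real.exp_le_exp.2 (by linarith [ht.1]))
  exact le_trans (cell_neg_shoulder (by norm_num) hv (by norm_num) hy) (by norm_num)

/-- Cell 14: `t ∈ (1.8, 2.12)`, `F ≤ 0`. -/
theorem swcell14 {y t : ℝ} (ht : t ∈ Set.Ioo (1.8 : ℝ) 2.12) (hy : y ≤ 0) :
    y * (2 * (Real.exp (t / 2) + (Real.exp (t / 2))⁻¹) - 2 * Real.exp (t / 2) ^ 3 / (Real.exp (t / 2) ^ 4 - 1)) +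
      2 * Real.exp (t / 2) ^ 2 / (Real.exp (t / 2) ^ 4 - 1) ≤ 0.3399 := by
  have hv : (2.459603111 : ℝ) ≤ Real.exp (t / 2) := le_trans sw_exp_ge_0_9 (Real.exp_le_exp.2 (by linarith [ht.1]))
  exact le_trans (cell_neg_shoulder (by norm_num) hv (by norm_num) hy) (by norm_num)

/-- Cell 15: `t ∈ (2.12, 2.52)`, `F ≤ 0`. -/
theorem swcell15 {y t : ℝ} (ht : t ∈ Set.Ioo (2.12 : ℝ) 2.52) (hy : y ≤ 0) :
    y * (2 * (Real.exp (t / 2) + (Real.exp (t / 2))⁻¹) - 2 * Real.exp (t / 2) ^ 3 / (Real.exp (t / 2) ^ 4 - 1)) +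
      2 * Real.exp (t / 2) ^ 2 / (Real.exp (t / 2) ^ 4 - 1) ≤ 0.24359 := by
  have hv : (2.886370989 : ℝ) ≤ Real.exp (t / 2) := le_trans sw_exp_ge_1_06 (Real.exp_le_exp.2 (by linarith [ht.1]))
  exact le_trans (cell_neg_shoulder (by norm_num) hv (by norm_num) hy) (by norm_num)

/-- Cell 16: `t ∈ (2.52, 3.0033)`, `F ≤ 0`. -/
theorem swcell16 {y t : ℝ} (ht : t ∈ Set.Ioo (2.52 : ℝ) 3.0033) (hy : y ≤ 0) :
    y * (2 * (Real.exp (t / 2) + (Real.exp (t / 2))⁻¹) - 2 * Real.exp (t / 2) ^ 3 / (Real.exp (t / 2) ^ 4 - 1)) +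
      2 * Real.exp (t / 2) ^ 2 / (Real.exp (t / 2) ^ 4 - 1) ≤ 0.16198 := by
  have hv : (3.525421487 : ℝ) ≤ Real.exp (t / 2) := le_trans sw_exp_ge_1_26 (Real.exp_le_exp.2 (by linarith [ht.1]))
  exact le_trans (cell_neg_shoulder (by norm_num) hv (by norm_num) hy) (by norm_num)

/-- Cell 17: `t ∈ (3.0033, 3.0401)`, `F = -1` (window plateau). -/
theorem swcell17 {y t : ℝ} (ht : t ∈ Set.Ioo (3.0033 : ℝ) 3.0401) (hy : y = -1) :
    y * (2 * (Real.exp (t / 2) + (Real.exp (t / 2))⁻¹) - 2 * Real.exp (t / 2) ^ 3 / (Real.exp (t / 2) ^ 4 - 1)) +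
      2 * Real.exp (t / 2) ^ 2 / (Real.exp (t / 2) ^ 4 - 1) ≤ -8.87757 := by
  subst hy
  have hv : (4.48908996 : ℝ) ≤ Real.exp (t / 2) := le_trans sw_exp_ge_1_50165 (Real.exp_le_exp.2 (by linarith [ht.1]))
  exact le_trans (cell_neg_one (by norm_num) hv) (by norm_num)

/-- Cell 18: `t ∈ (3.0401, 3.1814)`, `F ≤ 0`. -/
theorem swcell18 {y t : ℝ} (ht : t ∈ Set.Ioo (3.0401 : ℝ) 3.1814) (hy : y ≤ 0) :
    y * (2 * (Real.exp (t / 2) + (Real.exp (t / 2))⁻¹) - 2 * Real.exp (t / 2) ^ 3 / (Real.exp (t / 2) ^ 4 - 1)) +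
      2 * Real.exp (t / 2) ^ 2 / (Real.exp (t / 2) ^ 4 - 1) ≤ 0.09589 := by
  have hv : (4.572453811 : ℝ) ≤ Real.exp (t / 2) := le_trans sw_exp_ge_1_52005 (Real.exp_le_exp.2 (by linarith [ht.1]))
  exact le_trans (cell_neg_shoulder (by norm_num) hv (by norm_num) hy) (by norm_num)

/-- Cell 19: `t ∈ (3.1814, 3.2155)`, `F = -1` (window plateau). -/
theorem swcell19 {y t : ℝ} (ht : t ∈ Set.Ioo (3.1814 : ℝ) 3.2155) (hy : y = -1) :
    y * (2 * (Real.exp (t / 2) + (Real.exp (t / 2))⁻¹) - 2 * Real.exp (t / 2) ^ 3 / (Real.exp (t / 2) ^ 4 - 1)) +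
      2 * Real.exp (t / 2) ^ 2 / (Real.exp (t / 2) ^ 4 - 1) ≤ -9.73045 := by
  subst hy
  have hv : (4.907182753 : ℝ) ≤ Real.exp (t / 2) := le_trans sw_exp_ge_1_5907 (Real.exp_le_exp.2 (by linarith [ht.1]))
  exact le_trans (cell_neg_one (by norm_num) hv) (by norm_num)

/-- Cell 20: `t ∈ (3.2155, 3.2222)`, `F ≤ 0`. -/
theorem swcell20 {y t : ℝ} (ht : t ∈ Set.Ioo (3.2155 : ℝ) 3.2222) (hy : y ≤ 0) :
    y * (2 * (Real.exp (t / 2) + (Real.exp (t / 2))⁻¹) - 2 * Real.exp (t / 2) ^ 3 / (Real.exp (t / 2) ^ 4 - 1)) +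
      2 * Real.exp (t / 2) ^ 2 / (Real.exp (t / 2) ^ 4 - 1) ≤ 0.08042 := by
  have hv : (4.991567555 : ℝ) ≤ Real.exp (t / 2) := le_trans sw_exp_ge_1_60775 (Real.exp_le_exp.2 (by linarith [ht.1]))
  exact le_trans (cell_neg_shoulder (by norm_num) hv (by norm_num) hy) (by norm_num)

/-- Cell 21: `t ∈ (3.2222, 3.254)`, `F = -1` (window plateau). -/
theorem swcell21 {y t : ℝ} (ht : t ∈ Set.Ioo (3.2222 : ℝ) 3.254) (hy : y = -1) :
    y * (2 * (Real.exp (t / 2) + (Real.exp (t / 2))⁻¹) - 2 * Real.exp (t / 2) ^ 3 / (Real.exp (t / 2) ^ 4 - 1)) +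
      2 * Real.exp (t / 2) ^ 2 / (Real.exp (t / 2) ^ 4 - 1) ≤ -9.93612 := by
  subst hy
  have hv : (5.008317346 : ℝ) ≤ Real.exp (t / 2) := le_trans sw_exp_ge_1_6111 (Real.exp_le_exp.2 (by linarith [ht.1]))
  exact le_trans (cell_neg_one (by norm_num) hv) (by norm_num)

/-- Cell 22: `t ∈ (3.254, 3.2992)`, `F ≤ 0`. -/
theorem swcell22 {y t : ℝ} (ht : t ∈ Set.Ioo (3.254 : ℝ) 3.2992) (hy : y ≤ 0) :
    y * (2 * (Real.exp (t / 2) + (Real.exp (t / 2))⁻¹) - 2 * Real.exp (t / 2) ^ 3 / (Real.exp (t / 2) ^ 4 - 1)) +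
      2 * Real.exp (t / 2) ^ 2 / (Real.exp (t / 2) ^ 4 - 1) ≤ 0.07737 := by
  have hv : (5.088586037 : ℝ) ≤ Real.exp (t / 2) := le_trans sw_exp_ge_1_627 (Real.exp_le_exp.2 (by linarith [ht.1]))
  exact le_trans (cell_neg_shoulder (by norm_num) hv (by norm_num) hy) (by norm_num)

/-- Cell 23: `t ∈ (3.2992, 3.3282)`, `F = -1` (window plateau). -/
theorem swcell23 {y t : ℝ} (ht : t ∈ Set.Ioo (3.2992 : ℝ) 3.3282) (hy : y = -1) :
    y * (2 * (Real.exp (t / 2) + (Real.exp (t / 2))⁻¹) - 2 * Real.exp (t / 2) ^ 3 / (Real.exp (t / 2) ^ 4 - 1)) +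
      2 * Real.exp (t / 2) ^ 2 / (Real.exp (t / 2) ^ 4 - 1) ≤ -10.33533 := by
  subst hy
  have hv : (5.20489745 : ℝ) ≤ Real.exp (t / 2) := le_trans sw_exp_ge_1_6496 (Real.exp_le_exp.2 (by linarith [ht.1]))
  exact le_trans (cell_neg_one (by norm_num) hv) (by norm_num)

/-- Cell 24: `t ∈ (3.3282, 3.3312)`, `F ≤ 0`. -/
theorem swcell24 {y t : ℝ} (ht : t ∈ Set.Ioo (3.3282 : ℝ) 3.3312) (hy : y ≤ 0) :
    y * (2 * (Real.exp (t / 2) + (Real.exp (t / 2))⁻¹) - 2 * Real.exp (t / 2) ^ 3 / (Real.exp (t / 2) ^ 4 - 1)) +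
      2 * Real.exp (t / 2) ^ 2 / (Real.exp (t / 2) ^ 4 - 1) ≤ 0.07182 := by
  have hv : (5.280918282 : ℝ) ≤ Real.exp (t / 2) := le_trans sw_exp_ge_1_6641 (Real.exp_le_exp.2 (by linarith [ht.1]))
  exact le_trans (cell_neg_shoulder (by norm_num) hv (by norm_num) hy) (by norm_num)

/-! ## The numeric tail -/

/-- The numeric tail: `(2/(1 - e^{-6.6624})) e^{-3.3312} ≤ 0.07161`. -/
theorem sw_tail_numeric : 2 / (1 - Real.exp (-(2 * 3.3312))) * Real.exp (-(3.3312 : ℝ)) ≤ 0.07161 := by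
  have e1 : Real.exp (-(3.3312 : ℝ)) = (Real.exp 1.6656 ^ 2)⁻¹ := by
    rw [Real.exp_neg, ← Real.exp_nat_mul]; norm_num
  have e2 : Real.exp (-(2 * 3.3312 : ℝ)) = (Real.exp 1.6656 ^ 4)⁻¹ := by
    rw [Real.exp_neg, ← Real.exp_nat_mul]; norm_num
  rw [e1, e2]
  have hu0 : (5.288845603 : ℝ) ≤ Real.exp 1.6656 := sw_exp_ge_1_6656
  have hA : (Real.exp 1.6656 ^ 2)⁻¹ ≤ ((5.288845603 : ℝ) ^ 2)⁻¹ := by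
    apply inv_anti₀ (by positivity)
    gcongr
  have hB : 1 - ((5.288845603 : ℝ) ^ 4)⁻¹ ≤ 1 - (Real.exp 1.6656 ^ 4)⁻¹ := by
    have : (Real.exp 1.6656 ^ 4)⁻¹ ≤ ((5.288845603 : ℝ) ^ 4)⁻¹ := by
      apply inv_anti₀ (by positivity)
      gcongr
    linarith
  have hBpos : (0 : ℝ) < 1 - ((5.288845603 : ℝ) ^ 4)⁻¹ := by norm_num
  calc 2 / (1 - (Real.exp 1.6656 ^ 4)⁻¹) * (Real.exp 1.6656 ^ 2)⁻¹
      ≤ 2 / (1 - ((5.288845603 : ℝ) ^ 4)⁻¹) * ((5.288845603 : ℝ) ^ 2)⁻¹ :=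
        mul_le_mul (div_le_div_of_nonneg_left (by norm_num) hBpos hB) hA (by positivity) (by positivity)
    _ ≤ 0.07161 := by norm_num

end Summit.RiemannHypothesis.RiemannHypothesis.Theorems.OscSingleWindow.Negative

end
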